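import Summits.NavierStokesRegularity.NavierStokesRegularity.Theorems.TypeIIInviscidRelaxationAxisymSwirlRegularRadialLaplacianVorticity
import HarnessLib

/-!
# The Biot–Savart criterion with hypothesis only near the blow-up time

Helper toward the crux `AxisymSwirlRegular` (stmt-NavierStokesRegularity-1964, route TypeIIInviscidRelaxation),
criterion side of the registered line `radial_inflow_split` (stub `stub_oneSidedRadialCriterion`, ⟨19059⟩); sequel of
`…RadialLaplacianCriterion` / `…RadialLaplacianVorticity` (`RadialInflowEllipticGate.*`: a one-sided bound
`x_h·Δu_h = ∂_z(r ω_θ) ≤ K r²` on an axis tube over `[0,T)` ⇒ continuation).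

Here the bound is required only for `t ≥ T₁` (any `T₁ < T`): early times are covered by the sub-slab velocity bound
(`r u_r ≥ −r‖u‖ ≥ −ν` on `r < ν/(B⁺+1)`).  Consequently the blow-up readings hold ARBITRARILY CLOSE TO `T`:

* `hasSmoothExtensionPast_of_radialLaplacian_le_nearTop` / `hasSmoothExtensionPast_of_fderiv_swirl_curl_le_nearTop`
  — standing class + `x₀(Δu)₀ + x₁(Δu)₁ ≤ K r²` (resp. `∂₂ (swirl (curl u)) ≤ K r²`) on
  `{0 < cylRadius < δ} × [T₁,T)` for SOME `K`, `δ > 0`, `T₁ < T` ⇒ `HasSmoothExtensionPast ν 0 u T`;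
* `exists_fderiv_swirl_curl_gt_nearTop_of_not_hasSmoothExtensionPast` — blow-up ⇒ for every `T₁ < T`, `K`, `δ > 0`
  there are `t ∈ [T₁,T)` and `x`, `0 < cylRadius x < δ`, with `∂_z(r ω_θ)(t,x) > K r²`: along some `tₙ ↑ T`, `rₙ → 0`,
  `∂_z(ω_θ/r)(tₙ,xₙ) → +∞` — the one-sided axial vorticity gradient blows up AT THE AXIS AT THE BLOW-UP TIME.

A CRITERION; nothing here proves `stub_oneSidedRadialCriterion`, `AxisymSwirlRegular` or NavierStokesRegularity. [new]
-/

noncomputable section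

set_option linter.dupNamespace false

open Set Filter Topology Real WithLp Metric
open Literature.Analysis.FluidPDE
open scoped InnerProductSpace RealInnerProductSpace Laplacian ContDiff

namespace Summit.NavierStokesRegularity.NavierStokesRegularity.Theorems.RadialInflowEllipticGate

open Summit.NavierStokesRegularity.NavierStokesRegularity.Theorems
open Summit.NavierStokesRegularity.NavierStokesRegularity.Theorems.ScenarioCensus.LogGate

/-- **Continuation under a one-sided bound on `x_h·Δu_h` near the axis, near the top only.** In the standing class of
`stub_oneSidedRadialCriterion`: if `x₀(Δu)₀ + x₁(Δu)₁ (t,x) ≤ K · r²` whenever `t ∈ [0,T)`, `t ≥ T₁` and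
`0 < cylRadius x < δ` (some `K`, `δ > 0`, `T₁ < T`), then `HasSmoothExtensionPast ν 0 u T`.  Proof: as
`hasSmoothExtensionPast_of_radialLaplacian_le` for `t > max T₁ 0`; for `t ≤ max T₁ 0` the sub-slab bound `‖u‖ ≤ B`
gives `r u_r ≥ −r B⁺ ≥ −ν` on `r < ν/(B⁺+1)`. [new] -/
theorem hasSmoothExtensionPast_of_radialLaplacian_le_nearTop {ν T K δ T₁ : ℝ} (hν : 0 < ν) (hT : 0 < T)
    (hδ : 0 < δ) (hT₁ : T₁ < T)
    {u : ℝ → EuclideanSpace ℝ (Fin 3) → EuclideanSpace ℝ (Fin 3)} {p : ℝ → EuclideanSpace ℝ (Fin 3) → ℝ}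
    (hcl : IsClassicalNSSolutionOn (Ico 0 T) ν 0 u p) (hLH : IsLerayHopfOn T ν 0 (u 0) u)
    (hbd : ∀ T' < T, ∃ M : ℝ, ∀ t ∈ Icc 0 T', ∀ x, ‖u t x‖ ≤ M) (hax : ∀ t ∈ Ico 0 T, IsAxisymmetric (u t))
    (hdec : HasRapidSpatialDecay (u 0))
    (hK : ∀ t ∈ Ico 0 T, T₁ ≤ t → ∀ x : EuclideanSpace ℝ (Fin 3), 0 < cylRadius x → cylRadius x < δ →
      x 0 * (Δ (u t)) x 0 + x 1 * (Δ (u t)) x 1 ≤ K * cylRadius x ^ 2) :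
    HasSmoothExtensionPast ν 0 u T := by
  -- early slab
  set T₀ : ℝ := max T₁ 0 with hT₀_def
  have hT₀T : T₀ < T := max_lt hT₁ hT
  obtain ⟨B, hB⟩ := hbd T₀ hT₀T
  set B' : ℝ := max B 0 + 1 with hB'_def
  have hB'0 : 0 < B' := by positivity
  have hBB' : B ≤ B' := by linarith [le_max_left B 0]
  -- constants (as in `hasSmoothExtensionPast_of_radialLaplacian_le`)
  set K' : ℝ := max K 0 with hK'_def
  have hK'0 : 0 ≤ K' := le_max_right _ _
  have hKK' : K ≤ K' := le_max_left _ _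
  set ρ : ℝ := min (δ / 2) (min 1 (ν / (K' + 1))) with hρ_def
  have hρ0 : 0 < ρ := lt_min (half_pos hδ) (lt_min one_pos (div_pos hν (by positivity)))
  have hρδ : ρ < δ := (min_le_left _ _).trans_lt (half_lt_self hδ)
  have hρ1 : ρ ≤ 1 := (min_le_right _ _).trans (min_le_left _ _)
  have hρK : ρ ≤ ν / (K' + 1) := (min_le_right _ _).trans (min_le_right _ _)
  have hρ4 : K' * ρ ^ 4 ≤ ν := by
    have h1 : ρ ^ 4 ≤ ρ := by
      have h2 : ρ ^ 3 ≤ 1 := pow_le_one₀ hρ0.le hρ1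
      calc ρ ^ 4 = ρ ^ 3 * ρ := by ring
        _ ≤ 1 * ρ := mul_le_mul_of_nonneg_right h2 hρ0.le
        _ = ρ := one_mul ρ
    have h3 : K' * ρ ≤ ν := by
      have h4 : K' * (ν / (K' + 1)) ≤ ν := by
        rw [mul_div_assoc', div_le_iff₀ (by positivity)]
        nlinarith
      exact (mul_le_mul_of_nonneg_left hρK hK'0).trans h4
    linarith [mul_le_mul_of_nonneg_left h1 hK'0]
  obtain ⟨M, hM⟩ := offAxisBound ν T hν hT u p hcl hLH hbd hax hdec ρ hρ0
  set c : ℝ := ρ * max M 0 with hc_def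
  have hc0 : 0 ≤ c := by positivity
  set s : ℝ := Real.sqrt (ν / (2 * (c + 1))) with hs_def
  have hs0 : 0 < s := Real.sqrt_pos.2 (by positivity)
  have hs2 : s ^ 2 = ν / (2 * (c + 1)) := Real.sq_sqrt (by positivity)
  set δ' : ℝ := min (min (ρ / 2) (ρ * s)) (ν / B') with hδ'_def
  have hδ'0 : 0 < δ' := lt_min (lt_min (half_pos hρ0) (mul_pos hρ0 hs0)) (div_pos hν hB'0)
  have hδ'ρ : δ' < ρ := ((min_le_left _ _).trans (min_le_left _ _)).trans_lt (half_lt_self hρ0)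
  refine oneSidedRadialCriterion_of_lt_two (C := 1) hν hT one_lt_two hδ'0 hcl hLH hbd hax hdec ?_
  intro t ht x hxδ'
  rcases le_or_gt t T₀ with htT₀ | htT₀
  · -- early slab: `r u_r ≥ -r‖u‖ ≥ -r B' > -ν`
    have h1 := neg_cylRadius_mul_norm_le_radialMomentum x (u t x)
    have h2 : ‖u t x‖ ≤ B' := (hB t ⟨ht.1, htT₀⟩ x).trans hBB'
    have h3 : cylRadius x < ν / B' := hxδ'.trans_le (min_le_right _ _)
    have h4 : cylRadius x * B' < ν := by rwa [lt_div_iff₀ hB'0] at h3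
    have h5 : cylRadius x * ‖u t x‖ ≤ cylRadius x * B' := mul_le_mul_of_nonneg_left h2 (cylRadius_nonneg x)
    linarith
  have htT₁ : T₁ ≤ t := (le_max_left _ _).trans htT₀.le
  rcases (cylRadius_nonneg x).eq_or_lt with hx0 | hx0
  · have h0 := (cylRadius_eq_zero_iff x).1 hx0.symm
    rw [h0.1, h0.2]
    nlinarith
  have hxρ : cylRadius x < ρ := hxδ'.trans hδ'ρ
  have hv2 : ContDiff ℝ 2 (u t) := (hcl.contDiff_velocity ht).of_le (by norm_cast)
  obtain ⟨Bt, hBt⟩ := hbd t ht.2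
  have hBslice : ∀ y, ‖u t y‖ ≤ Bt := fun y => hBt t ⟨ht.1, le_rfl⟩ y
  have hlap_t : ∀ y : EuclideanSpace ℝ (Fin 3), 0 < cylRadius y → cylRadius y < ρ →
      y 0 * (Δ (u t)) y 0 + y 1 * (Δ (u t)) y 1 ≤ K' * cylRadius y ^ 2 := fun y hy hyρ =>
    (hK t ht htT₁ y hy (hyρ.trans hρδ)).trans (mul_le_mul_of_nonneg_right hKK' (sq_nonneg _))
  have hgate_t : ∀ y : EuclideanSpace ℝ (Fin 3), cylRadius y = ρ → -c ≤ y 0 * u t y 0 + y 1 * u t y 1 := by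
    intro y hy
    have h1 := neg_cylRadius_mul_norm_le_radialMomentum y (u t y)
    have h2 : ‖u t y‖ ≤ max M 0 := (hM t ht y hy.symm.le).trans (le_max_left _ _)
    have h3 : cylRadius y * ‖u t y‖ ≤ ρ * max M 0 := by
      rw [hy]; exact mul_le_mul_of_nonneg_left h2 hρ0.le
    simp only [hc_def]
    linarith
  have hΦ := radialMomentum_ge_quadratic_of_radialLaplacian_le hv2 (hax t ht) hBslice hρ0 hc0 hK'0
    hlap_t hgate_t hx0 hxρ
  have h1 : c * cylRadius x ^ 2 / ρ ^ 2 ≤ ν / 2 := by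
    have hrs : cylRadius x < ρ * s := hxδ'.trans_le ((min_le_left _ _).trans (min_le_right _ _))
    have hrs2 : cylRadius x ^ 2 ≤ (ρ * s) ^ 2 := pow_le_pow_left₀ (cylRadius_nonneg x) hrs.le 2
    have h2 : cylRadius x ^ 2 / ρ ^ 2 ≤ s ^ 2 := by
      rw [div_le_iff₀ (by positivity)]
      nlinarith
    have h3 : c * s ^ 2 ≤ ν / 2 := by
      rw [hs2, mul_div_assoc', div_le_iff₀ (by positivity)]
      nlinarith
    calc c * cylRadius x ^ 2 / ρ ^ 2 = c * (cylRadius x ^ 2 / ρ ^ 2) := by ring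
      _ ≤ c * s ^ 2 := mul_le_mul_of_nonneg_left h2 hc0
      _ ≤ ν / 2 := h3
  have h2 : K' / 8 * (ρ ^ 4 - cylRadius x ^ 4) ≤ ν / 8 := by
    have h3 : 0 ≤ cylRadius x ^ 4 := by positivity
    nlinarith
  linarith

/-- **Vorticity form, near the top only.** Standing class + `∂₂ (swirl (curl (u t))) (x) = ∂_z(r ω_θ)(t,x) ≤ K · r²`
on `{0 < cylRadius x < δ} × ([T₁,T) ∩ [0,T))` for SOME `K`, `δ > 0`, `T₁ < T` ⇒ `HasSmoothExtensionPast ν 0 u T`.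
[new] -/
theorem hasSmoothExtensionPast_of_fderiv_swirl_curl_le_nearTop {ν T K δ T₁ : ℝ} (hν : 0 < ν) (hT : 0 < T)
    (hδ : 0 < δ) (hT₁ : T₁ < T)
    {u : ℝ → EuclideanSpace ℝ (Fin 3) → EuclideanSpace ℝ (Fin 3)} {p : ℝ → EuclideanSpace ℝ (Fin 3) → ℝ}
    (hcl : IsClassicalNSSolutionOn (Ico 0 T) ν 0 u p) (hLH : IsLerayHopfOn T ν 0 (u 0) u)
    (hbd : ∀ T' < T, ∃ M : ℝ, ∀ t ∈ Icc 0 T', ∀ x, ‖u t x‖ ≤ M) (hax : ∀ t ∈ Ico 0 T, IsAxisymmetric (u t))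
    (hdec : HasRapidSpatialDecay (u 0))
    (hK : ∀ t ∈ Ico 0 T, T₁ ≤ t → ∀ x : EuclideanSpace ℝ (Fin 3), 0 < cylRadius x → cylRadius x < δ →
      fderiv ℝ (swirl (curl (u t))) x (EuclideanSpace.single 2 1) ≤ K * cylRadius x ^ 2) :
    HasSmoothExtensionPast ν 0 u T := by
  refine hasSmoothExtensionPast_of_radialLaplacian_le_nearTop (K := K) hν hT hδ hT₁ hcl hLH hbd hax hdec ?_
  intro t ht htT₁ x hx hxδ
  have hu2 : ContDiff ℝ 2 (u t) := (hcl.contDiff_velocity ht).of_le (by norm_cast)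
  rw [radialLaplacian_eq_fderiv_swirl_curl hu2 (hax t ht) (hcl.divFree t ht) x]
  exact hK t ht htT₁ x hx hxδ

/-- **Blow-up reading: the one-sided axial vorticity gradient blows up at the axis at the blow-up time.** In the
standing class, if the solution does NOT extend smoothly past `T`, then for every `T₁ < T`, every `K` and every
`δ > 0` there are `t ∈ [0,T)` with `t ≥ T₁` and `x` with `0 < cylRadius x < δ` such that
`∂_z(r ω_θ)(t,x) > K · r²` (i.e. `∂_z(ω_θ/r)(t,x) > K`). [new] -/
theorem exists_fderiv_swirl_curl_gt_nearTop_of_not_hasSmoothExtensionPast {ν T : ℝ} (hν : 0 < ν) (hT : 0 < T)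
    {u : ℝ → EuclideanSpace ℝ (Fin 3) → EuclideanSpace ℝ (Fin 3)} {p : ℝ → EuclideanSpace ℝ (Fin 3) → ℝ}
    (hcl : IsClassicalNSSolutionOn (Ico 0 T) ν 0 u p) (hLH : IsLerayHopfOn T ν 0 (u 0) u)
    (hbd : ∀ T' < T, ∃ M : ℝ, ∀ t ∈ Icc 0 T', ∀ x, ‖u t x‖ ≤ M) (hax : ∀ t ∈ Ico 0 T, IsAxisymmetric (u t))
    (hdec : HasRapidSpatialDecay (u 0)) (hno : ¬ HasSmoothExtensionPast ν 0 u T)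
    {T₁ : ℝ} (hT₁ : T₁ < T) (K : ℝ) {δ : ℝ} (hδ : 0 < δ) :
    ∃ t ∈ Ico 0 T, T₁ ≤ t ∧ ∃ x : EuclideanSpace ℝ (Fin 3), 0 < cylRadius x ∧ cylRadius x < δ ∧
      K * cylRadius x ^ 2 < fderiv ℝ (swirl (curl (u t))) x (EuclideanSpace.single 2 1) := by
  by_contra hcon
  refine hno (hasSmoothExtensionPast_of_fderiv_swirl_curl_le_nearTop (K := K) hν hT hδ hT₁ hcl hLH hbd hax hdec ?_)
  intro t ht htT₁ x hx hxδ
  by_contra hlt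
  exact hcon ⟨t, ht, htT₁, x, hx, hxδ, lt_of_not_ge hlt⟩

end Summit.NavierStokesRegularity.NavierStokesRegularity.Theorems.RadialInflowEllipticGate

end
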